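import Mathlib
import Summits.NavierStokesRegularity.NavierStokesRegularity.Theorems.SubcriticalEnvelopeForwardSourceTailEnvelopeKPPerm
import HarnessLib

/-!
# `SubcriticalEnvelope.ForwardSourceTailEnvelopeKP` (stmt-NavierStokesRegularity-27130) — uniform KP FAN
networks (branching AND merging feeds): closed forms and the EXACT REDUCTION to one chain (file 1 of 3
of the LEAD-SE rung «uniform KP fan networks», `--supports`)

LEAD-SE helper.  The fan network `kpFanTable w` (`Theorems/SubcriticalEnvelopeDefs.lean`): every
component feeds every component one shell up, the target `i` receiving the share `w i` from each
source (rank-one feed matrix; no in-shell coupling).  It is the simplest KP-proper architecture with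
branching and merging; no strand decomposition exists (a mode has four parents and four children).
REDUCTION along every honest viscous solution from ANY one-shell datum `X₀` (for `w ≥ 0`):
(a) the datum shell decays COHERENTLY, `X_{a,0}(t) = X₀(a)·g(t)` — the Wronskians
`X_{a,0}X₀(b) − X_{b,0}X₀(a)` obey `W' = −λ₀(t)W` with `λ₀ = Σ_j w_j X_{j,1} + ν ≥ 0` and `W(0) = 0`;
(b) every higher shell is PARALLEL to `w`: `X_{i,k} = w_i·(w·X_{·,k})/|w|²` (`k ≥ 1`) — the part of
`X_{·,k}` orthogonal to `w` obeys `v' = −λ_k(t)v`, `λ_k ≥ 0`, `v(0) = 0` (the feed is parallel to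
`w`, the drain is a scalar multiple of the mode).

* `kpFanTable_feed/_up1/_up2/_inshell`, `quadTerm_kpFan` — closed forms; the nonlinearity
  `w_i·(1+ε₀)^{5(n-1)/2}·Σ_a X_{a,n-1}² − (1+ε₀)^{5n/2}·X_{i,n}·Σ_j w_j X_{j,n+1}`;
* `sq_le_sq_init_of_damped_var`, `eq_zero_of_damped_var` — `y' = −λ(t)y`, `λ ≥ 0` ⇒ `y² ≤ y(0)²`;
* `kpFan_datumShell_deriv/_sq_le`, `kpFan_wronskian_zero`, `kpFan_datumShell_normSq` — (a);
* `kpFan_moment_deriv`, `kpFan_parallel` — (b).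

Siblings: `…KPFanTransfer.lean` (chain ⇒ fan, ratio-agnostic) and `…KPFan.lean` (class, rung on
`ε₀ ∈ [31/50, 1]`).

HONEST FRAMING: algebra and elementary ODE bookkeeping about Tao-type MODEL lattice ODEs (rung
TL-M2Break); no crux is proved; nothing here concerns the Navier–Stokes equations; NS regularity is
NOT advanced.
-/

noncomputable section

-- the sub-problem namespace `NavierStokesRegularity.NavierStokesRegularity` is the tree's layout (D-0017)
set_option linter.dupNamespace false

namespace Summit.NavierStokesRegularity.NavierStokesRegularity.Theorems

open Set
open Literature.Analysis.FluidPDE.TaoCascade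
open Summit.NavierStokesRegularity.NavierStokesRegularity.Theorems.SubOnsagerCeiling
open Summit.NavierStokesRegularity.NavierStokesRegularity.Theses


/-! ## §1 Closed forms and the nonlinearity -/

/-- Values on the feed shift `(0,0,1)`. [this file] -/
theorem kpFanTable_feed (w : Fin 4 → ℝ) (i₁ i₂ i₃ : Fin 4) :
    kpFanTable w i₁ i₂ i₃ ((0 : ℤ), (0 : ℤ), (1 : ℤ)) = if i₁ = i₂ then w i₃ else 0 := by
  simp [kpFanTable]

/-- Values on the shift `(1,0,0)`. [this file] -/
theorem kpFanTable_up1 (w : Fin 4 → ℝ) (i₁ i₂ i₃ : Fin 4) :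
    kpFanTable w i₁ i₂ i₃ ((1 : ℤ), (0 : ℤ), (0 : ℤ)) = if i₂ = i₃ then -(w i₁ / 2) else 0 := by
  simp [kpFanTable]

/-- Values on the shift `(0,1,0)`. [this file] -/
theorem kpFanTable_up2 (w : Fin 4 → ℝ) (i₁ i₂ i₃ : Fin 4) :
    kpFanTable w i₁ i₂ i₃ ((0 : ℤ), (1 : ℤ), (0 : ℤ)) = if i₁ = i₃ then -(w i₂ / 2) else 0 := by
  simp [kpFanTable]

/-- Values on the in-shell shift `(0,0,0)`: none. [this file] -/
theorem kpFanTable_inshell (w : Fin 4 → ℝ) (i₁ i₂ i₃ : Fin 4) :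
    kpFanTable w i₁ i₂ i₃ ((0 : ℤ), (0 : ℤ), (0 : ℤ)) = 0 := by
  simp [kpFanTable]

/-- **The fan nonlinearity of the mode `(i, n)`**: fed by the total energy one shell below with share
`w i`, drained by its feeds into every `(j, n+1)`. [this file] -/
theorem quadTerm_kpFan (ε₀ : ℝ) (w : Fin 4 → ℝ) (X : Fin 4 → ℤ → ℝ → ℝ) (i : Fin 4) (n : ℤ)
    (t : ℝ) :
    quadTerm ε₀ (kpFanTable w) X i n t =
      w i * ((1 + ε₀) ^ ((5 : ℝ) * (n - 1) / 2) * ∑ a, X a (n - 1) t ^ 2) -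
        (1 + ε₀) ^ ((5 : ℝ) * n / 2) * (X i n t * ∑ j, w j * X j (n + 1) t) := by
  rw [quadTerm_four_shifts]
  have hfeed : ∑ i₁, ∑ i₂, kpFanTable w i₁ i₂ i (0, 0, 1) * (X i₁ (n - 1) t * X i₂ (n - 1) t) =
      w i * ∑ a, X a (n - 1) t ^ 2 := by
    rw [Finset.mul_sum]
    refine Finset.sum_congr rfl fun a _ => ?_
    rw [Finset.sum_eq_single a]
    · rw [kpFanTable_feed, if_pos rfl]; ring
    · intro b _ hb; rw [kpFanTable_feed, if_neg (Ne.symm hb), zero_mul]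
    · intro h'; exact absurd (Finset.mem_univ a) h'
  have hrest : ∑ i₁, ∑ i₂, (kpFanTable w i₁ i₂ i (0, 0, 0) * (X i₁ n t * X i₂ n t) +
      kpFanTable w i₁ i₂ i (1, 0, 0) * (X i₁ (n + 1) t * X i₂ n t) +
      kpFanTable w i₁ i₂ i (0, 1, 0) * (X i₁ n t * X i₂ (n + 1) t)) =
      -(X i n t * ∑ j, w j * X j (n + 1) t) := by
    have h1 : ∑ i₁, ∑ i₂, kpFanTable w i₁ i₂ i (1, 0, 0) * (X i₁ (n + 1) t * X i₂ n t) =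
        ∑ j, -(w j / 2) * (X j (n + 1) t * X i n t) := by
      refine Finset.sum_congr rfl fun j _ => ?_
      rw [Finset.sum_eq_single i]
      · rw [kpFanTable_up1, if_pos rfl]
      · intro b _ hb; rw [kpFanTable_up1, if_neg hb, zero_mul]
      · intro h'; exact absurd (Finset.mem_univ i) h'
    have h2 : ∑ i₁, ∑ i₂, kpFanTable w i₁ i₂ i (0, 1, 0) * (X i₁ n t * X i₂ (n + 1) t) =
        ∑ j, -(w j / 2) * (X i n t * X j (n + 1) t) := by
      rw [Finset.sum_eq_single i]
      · refine Finset.sum_congr rfl fun j _ => ?_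
        rw [kpFanTable_up2, if_pos rfl]
      · intro b _ hb
        exact Finset.sum_eq_zero fun j _ => by rw [kpFanTable_up2, if_neg hb, zero_mul]
      · intro h'; exact absurd (Finset.mem_univ i) h'
    simp only [Finset.sum_add_distrib, kpFanTable_inshell, zero_mul, zero_add]
    rw [h1, h2, Finset.mul_sum, ← Finset.sum_add_distrib, ← Finset.sum_neg_distrib]
    exact Finset.sum_congr rfl fun j _ => by ring
  have hn : ((5 : ℝ) * ((n : ℝ) - 1) / 2) = (5 : ℝ) * (n - 1) / 2 := by ring
  rw [hrest, hfeed, hn]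
  ring

/-- The fan nonlinearity vanishes identically when `w = 0`. [this file] -/
theorem quadTerm_kpFan_zero (ε₀ : ℝ) {w : Fin 4 → ℝ} (hw : ∀ j, w j = 0)
    (X : Fin 4 → ℤ → ℝ → ℝ) (i : Fin 4) (n : ℤ) (t : ℝ) : quadTerm ε₀ (kpFanTable w) X i n t = 0 := by
  rw [quadTerm_kpFan]; simp [hw]

/-! ## §2 Linear damping with a time-dependent non-negative rate -/

/-- **A linearly damped quantity does not grow in square.** If `y' = −λ(t)·y` within `[0, s]` with
`λ ≥ 0` there, then `y(t)² ≤ y(0)²` on `[0, s]`.  Elementary calculus. [this file] -/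
theorem sq_le_sq_init_of_damped_var {y lam : ℝ → ℝ} {s : ℝ} (hy : Continuous y)
    (hlam : ∀ t ∈ Icc (0 : ℝ) s, 0 ≤ lam t)
    (hode : ∀ t ∈ Icc (0 : ℝ) s, HasDerivWithinAt y (-lam t * y t) (Icc 0 s) t) :
    ∀ t ∈ Icc (0 : ℝ) s, y t ^ 2 ≤ y 0 ^ 2 := by
  intro t ht
  have hanti : AntitoneOn (fun u => y u * y u) (Icc 0 s) := by
    apply antitoneOn_of_hasDerivWithinAt_nonpos (convex_Icc 0 s)
      (f' := fun u => (-lam u * y u) * y u + y u * (-lam u * y u))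
    · exact (hy.mul hy).continuousOn
    · intro u hu
      have hd := (hode u (interior_subset hu)).mono (interior_subset (s := Icc (0 : ℝ) s))
      exact hd.mul hd
    · intro u hu
      have h0 : 0 ≤ lam u := hlam u (interior_subset hu)
      nlinarith [mul_self_nonneg (y u)]
  have := hanti ⟨le_refl 0, ht.1.trans ht.2⟩ ht ht.1
  simpa only [sq] using this

/-- Corollary: started from `0` it stays `0`. [this file] -/
theorem eq_zero_of_damped_var {y lam : ℝ → ℝ} {s : ℝ} (hy : Continuous y)
    (hlam : ∀ t ∈ Icc (0 : ℝ) s, 0 ≤ lam t)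
    (hode : ∀ t ∈ Icc (0 : ℝ) s, HasDerivWithinAt y (-lam t * y t) (Icc 0 s) t) (h0 : y 0 = 0) :
    ∀ t ∈ Icc (0 : ℝ) s, y t = 0 := by
  intro t ht
  have h := sq_le_sq_init_of_damped_var hy hlam hode t ht
  rw [h0] at h
  nlinarith [sq_nonneg (y t)]

/-! ## §3 The reduction: coherent datum shell, higher shells parallel to `w` -/

section Reduction

variable {ε₀ ν s : ℝ} {w : Fin 4 → ℝ} {X₀ : Fin 4 → ℝ} {X : Fin 4 → ℤ → ℝ → ℝ}

/-- **The datum shell of a fan solution is linearly damped**: `Ẋ_{a,0} = −λ₀(t)·X_{a,0}` with the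
common rate `λ₀ = Σ_j w_j X_{j,1} + ν ≥ 0` (no feed from shell `−1`). [this file] -/
theorem kpFan_datumShell_deriv
    (hlow : ∀ (i : Fin 4) (k : ℤ), k < 0 → ∀ t : ℝ, X i k t = 0)
    (hder : ∀ (i : Fin 4) (k : ℤ), ∀ t ∈ Icc (0 : ℝ) s, HasDerivWithinAt (X i k)
      (quadTerm ε₀ (kpFanTable w) X i k t - ν * (1 + ε₀) ^ ((2 : ℝ) * k) * X i k t)
      (Icc (0 : ℝ) s) t)
    (a : Fin 4) : ∀ t ∈ Icc (0 : ℝ) s, HasDerivWithinAt (X a 0)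
      (-((∑ j, w j * X j 1 t) + ν) * X a 0 t) (Icc (0 : ℝ) s) t := by
  intro t ht
  have h := hder a 0 t ht
  rw [quadTerm_kpFan] at h
  have h1 : ∑ b, X b (0 - 1) t ^ 2 = 0 :=
    Finset.sum_eq_zero fun b _ => by rw [hlow b (0 - 1) (by norm_num) t]; ring
  rw [h1] at h
  convert h using 1
  push_cast
  simp only [mul_zero, zero_div, Real.rpow_zero]
  ring

/-- **The datum shell decays coherently**: all Wronskians `X_{a,0}X₀(b) − X_{b,0}X₀(a)` vanish on
`[0, s]` (they obey `W' = −λ₀W`, `λ₀ ≥ 0`, `W(0) = 0`). [this file] -/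
theorem kpFan_wronskian_zero (hw : ∀ j, 0 ≤ w j)
    (hinit : ∀ (i : Fin 4) (k : ℤ), X i k 0 = if k = 0 then X₀ i else 0)
    (hlow : ∀ (i : Fin 4) (k : ℤ), k < 0 → ∀ t : ℝ, X i k t = 0)
    (hcont : ∀ (i : Fin 4) (k : ℤ), Continuous (X i k))
    (hder : ∀ (i : Fin 4) (k : ℤ), ∀ t ∈ Icc (0 : ℝ) s, HasDerivWithinAt (X i k)
      (quadTerm ε₀ (kpFanTable w) X i k t - ν * (1 + ε₀) ^ ((2 : ℝ) * k) * X i k t)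
      (Icc (0 : ℝ) s) t)
    (hnn : ∀ t ∈ Icc (0 : ℝ) s, ∀ (i : Fin 4) (k : ℤ), 1 ≤ k → 0 ≤ X i k t) (hν : 0 ≤ ν)
    (a b : Fin 4) : ∀ t ∈ Icc (0 : ℝ) s, X a 0 t * X₀ b = X b 0 t * X₀ a := by
  have hlam : ∀ t ∈ Icc (0 : ℝ) s, 0 ≤ (∑ j, w j * X j 1 t) + ν := fun t ht =>
    add_nonneg (Finset.sum_nonneg fun j _ => mul_nonneg (hw j) (hnn t ht j 1 le_rfl)) hν
  have hd : ∀ t ∈ Icc (0 : ℝ) s, HasDerivWithinAt (fun t => X a 0 t * X₀ b - X b 0 t * X₀ a)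
      (-((∑ j, w j * X j 1 t) + ν) * (X a 0 t * X₀ b - X b 0 t * X₀ a)) (Icc (0 : ℝ) s) t := by
    intro t ht
    have ha := (kpFan_datumShell_deriv hlow hder a t ht).mul_const (X₀ b)
    have hb := (kpFan_datumShell_deriv hlow hder b t ht).mul_const (X₀ a)
    exact (ha.sub hb).congr_deriv (by ring)
  have hW := eq_zero_of_damped_var (y := fun t => X a 0 t * X₀ b - X b 0 t * X₀ a)
    (lam := fun t => (∑ j, w j * X j 1 t) + ν) (s := s)
    (((hcont a 0).mul continuous_const).sub ((hcont b 0).mul continuous_const)) hlam hd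
    (by simp [hinit, mul_comm])
  intro t ht
  have := hW t ht
  linarith

/-- **Each datum-shell amplitude does not grow in square**: `X_{a,0}(t)² ≤ X₀(a)²`. [this file] -/
theorem kpFan_datumShell_sq_le (hw : ∀ j, 0 ≤ w j)
    (hinit : ∀ (i : Fin 4) (k : ℤ), X i k 0 = if k = 0 then X₀ i else 0)
    (hlow : ∀ (i : Fin 4) (k : ℤ), k < 0 → ∀ t : ℝ, X i k t = 0)
    (hcont : ∀ (i : Fin 4) (k : ℤ), Continuous (X i k))
    (hder : ∀ (i : Fin 4) (k : ℤ), ∀ t ∈ Icc (0 : ℝ) s, HasDerivWithinAt (X i k)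
      (quadTerm ε₀ (kpFanTable w) X i k t - ν * (1 + ε₀) ^ ((2 : ℝ) * k) * X i k t)
      (Icc (0 : ℝ) s) t)
    (hnn : ∀ t ∈ Icc (0 : ℝ) s, ∀ (i : Fin 4) (k : ℤ), 1 ≤ k → 0 ≤ X i k t) (hν : 0 ≤ ν)
    (a : Fin 4) : ∀ t ∈ Icc (0 : ℝ) s, X a 0 t ^ 2 ≤ X₀ a ^ 2 := by
  have hlam : ∀ t ∈ Icc (0 : ℝ) s, 0 ≤ (∑ j, w j * X j 1 t) + ν := fun t ht =>
    add_nonneg (Finset.sum_nonneg fun j _ => mul_nonneg (hw j) (hnn t ht j 1 le_rfl)) hν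
  have h := sq_le_sq_init_of_damped_var (y := X a 0) (lam := fun t => (∑ j, w j * X j 1 t) + ν)
    (s := s) (hcont a 0) hlam (kpFan_datumShell_deriv hlow hder a)
  intro t ht
  have := h t ht
  rwa [hinit a 0, if_pos rfl] at this

/-- The derivative of the `w`-moment `Σ_j w_j X_{j,k}` of a shell. [this file] -/
theorem kpFan_moment_deriv
    (hder : ∀ (i : Fin 4) (k : ℤ), ∀ t ∈ Icc (0 : ℝ) s, HasDerivWithinAt (X i k)
      (quadTerm ε₀ (kpFanTable w) X i k t - ν * (1 + ε₀) ^ ((2 : ℝ) * k) * X i k t)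
      (Icc (0 : ℝ) s) t)
    (k : ℤ) : ∀ t ∈ Icc (0 : ℝ) s, HasDerivWithinAt (fun t => ∑ j, w j * X j k t)
      ((∑ j, w j ^ 2) * ((1 + ε₀) ^ ((5 : ℝ) * (k - 1) / 2) * ∑ a, X a (k - 1) t ^ 2) -
        ((1 + ε₀) ^ ((5 : ℝ) * k / 2) * (∑ j, w j * X j (k + 1) t) + ν * (1 + ε₀) ^ ((2 : ℝ) * k)) *
          (∑ j, w j * X j k t)) (Icc (0 : ℝ) s) t := by
  intro t ht
  have h := HasDerivWithinAt.fun_sum (u := Finset.univ)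
    (A := fun j t => w j * X j k t) fun j _ => (hder j k t ht).const_mul (w j)
  refine h.congr_deriv ?_
  have e : ∀ i, w i * (quadTerm ε₀ (kpFanTable w) X i k t - ν * (1 + ε₀) ^ ((2 : ℝ) * k) * X i k t) =
      w i ^ 2 * ((1 + ε₀) ^ ((5 : ℝ) * (k - 1) / 2) * ∑ a, X a (k - 1) t ^ 2) -
        ((1 + ε₀) ^ ((5 : ℝ) * k / 2) * (∑ j, w j * X j (k + 1) t) + ν * (1 + ε₀) ^ ((2 : ℝ) * k)) *
          (w i * X i k t) := fun i => by rw [quadTerm_kpFan]; ring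
  rw [Finset.sum_congr rfl fun i _ => e i, Finset.sum_sub_distrib, ← Finset.sum_mul, ← Finset.mul_sum]

/-- **Higher shells are parallel to `w`**: for `k ≥ 1`, `X_{i,k} = w_i·(Σ_j w_j X_{j,k})/|w|²` on
`[0, s]` (the part of `X_{·,k}` orthogonal to `w` obeys `v' = −λ_k v`, `λ_k ≥ 0`, `v(0) = 0`: the
feed is parallel to `w`, the drain is a scalar multiple of the mode). [this file] -/
theorem kpFan_parallel (hw : ∀ j, 0 ≤ w j) (hW : (∑ j, w j ^ 2) ≠ 0)
    (hinit : ∀ (i : Fin 4) (k : ℤ), X i k 0 = if k = 0 then X₀ i else 0)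
    (hcont : ∀ (i : Fin 4) (k : ℤ), Continuous (X i k))
    (hder : ∀ (i : Fin 4) (k : ℤ), ∀ t ∈ Icc (0 : ℝ) s, HasDerivWithinAt (X i k)
      (quadTerm ε₀ (kpFanTable w) X i k t - ν * (1 + ε₀) ^ ((2 : ℝ) * k) * X i k t)
      (Icc (0 : ℝ) s) t)
    (hnn : ∀ t ∈ Icc (0 : ℝ) s, ∀ (i : Fin 4) (k : ℤ), 1 ≤ k → 0 ≤ X i k t)
    (hε : 0 < 1 + ε₀) (hν : 0 ≤ ν) {k : ℤ} (hk : 1 ≤ k) (i : Fin 4) :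
    ∀ t ∈ Icc (0 : ℝ) s, X i k t = w i * ((∑ j, w j * X j k t) / ∑ j, w j ^ 2) := by
  set W2 : ℝ := ∑ j, w j ^ 2 with hW2
  set lam : ℝ → ℝ := fun t =>
    (1 + ε₀) ^ ((5 : ℝ) * k / 2) * (∑ j, w j * X j (k + 1) t) + ν * (1 + ε₀) ^ ((2 : ℝ) * k)
    with hlam_def
  have hlam : ∀ t ∈ Icc (0 : ℝ) s, 0 ≤ lam t := by
    intro t ht
    have h1 : 0 ≤ ∑ j, w j * X j (k + 1) t :=
      Finset.sum_nonneg fun j _ => mul_nonneg (hw j) (hnn t ht j (k + 1) (by omega))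
    have h2 : 0 ≤ (1 + ε₀) ^ ((5 : ℝ) * k / 2) := Real.rpow_nonneg hε.le _
    have h3 : 0 ≤ (1 + ε₀) ^ ((2 : ℝ) * k) := Real.rpow_nonneg hε.le _
    simp only [hlam_def]
    positivity
  -- the orthogonal part `v = X_i − w_i m / W2`
  have hd : ∀ t ∈ Icc (0 : ℝ) s, HasDerivWithinAt (fun t => X i k t - w i * ((∑ j, w j * X j k t) / W2))
      (-lam t * (X i k t - w i * ((∑ j, w j * X j k t) / W2))) (Icc (0 : ℝ) s) t := by
    intro t ht
    have hX := hder i k t ht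
    have hm := ((kpFan_moment_deriv hder k t ht).div_const W2).const_mul (w i)
    rw [quadTerm_kpFan] at hX
    refine (hX.sub hm).congr_deriv ?_
    simp only [hlam_def]
    field_simp
    ring
  have hv := eq_zero_of_damped_var
    (y := fun t => X i k t - w i * ((∑ j, w j * X j k t) / W2)) (lam := lam) (s := s)
    ((hcont i k).sub (continuous_const.mul
      ((continuous_finsetSum _ fun j _ => continuous_const.mul (hcont j k)).div_const _)))
    hlam hd
    (by simp [hinit, show k ≠ 0 by omega])
  intro t ht
  have := hv t ht
  linarith

end Reduction

/-! ## §4 Coherence of the datum shell (squared form) -/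

section Transfer

variable {ε₀ ν s : ℝ} {w : Fin 4 → ℝ} {X₀ : Fin 4 → ℝ} {X : Fin 4 → ℤ → ℝ → ℝ}

/-- **Coherence of the datum shell, squared form**: `Σ_a X_{a,0}(t)² = |X₀|²·g(t)²` with
`g = (X₀·X_{·,0})/|X₀|²` (and both sides `0` when `X₀ = 0`). [this file] -/
theorem kpFan_datumShell_normSq (hw : ∀ j, 0 ≤ w j)
    (hinit : ∀ (i : Fin 4) (k : ℤ), X i k 0 = if k = 0 then X₀ i else 0)
    (hlow : ∀ (i : Fin 4) (k : ℤ), k < 0 → ∀ t : ℝ, X i k t = 0)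
    (hcont : ∀ (i : Fin 4) (k : ℤ), Continuous (X i k))
    (hder : ∀ (i : Fin 4) (k : ℤ), ∀ t ∈ Icc (0 : ℝ) s, HasDerivWithinAt (X i k)
      (quadTerm ε₀ (kpFanTable w) X i k t - ν * (1 + ε₀) ^ ((2 : ℝ) * k) * X i k t)
      (Icc (0 : ℝ) s) t)
    (hnn : ∀ t ∈ Icc (0 : ℝ) s, ∀ (i : Fin 4) (k : ℤ), 1 ≤ k → 0 ≤ X i k t) (hν : 0 ≤ ν) :
    ∀ t ∈ Icc (0 : ℝ) s, ∀ a : Fin 4,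
      X a 0 t = X₀ a * ((∑ b, X₀ b * X b 0 t) / ∑ b, X₀ b ^ 2) := by
  intro t ht a
  by_cases hN : (∑ b, X₀ b ^ 2) = 0
  · -- `X₀ = 0`: the datum shell vanishes identically
    have hX0 : ∀ b, X₀ b = 0 := fun b => by
      have := (Finset.sum_eq_zero_iff_of_nonneg fun b _ => sq_nonneg (X₀ b)).1 hN b (Finset.mem_univ b)
      exact pow_eq_zero_iff (n := 2) (by norm_num) |>.1 this
    have h := kpFan_datumShell_sq_le hw hinit hlow hcont hder hnn hν a t ht
    rw [hX0 a] at h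
    have : X a 0 t = 0 := by nlinarith [sq_nonneg (X a 0 t)]
    rw [this, hX0 a, zero_mul]
  · have key : (∑ b, X₀ b ^ 2) * X a 0 t = X₀ a * ∑ b, X₀ b * X b 0 t := by
      rw [Finset.sum_mul, Finset.mul_sum]
      refine Finset.sum_congr rfl fun b _ => ?_
      have hwr := kpFan_wronskian_zero hw hinit hlow hcont hder hnn hν a b t ht
      calc X₀ b ^ 2 * X a 0 t = X₀ b * (X a 0 t * X₀ b) := by ring
        _ = X₀ b * (X b 0 t * X₀ a) := by rw [hwr]
        _ = X₀ a * (X₀ b * X b 0 t) := by ring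
    field_simp
    linarith [key]

end Transfer

end Summit.NavierStokesRegularity.NavierStokesRegularity.Theorems

end
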